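import Summits.BirchSwinnertonDyer.BirchSwinnertonDyer.Theorems.ManinLocalTwoThreeEulerRemaindersTwenty
import Summits.BirchSwinnertonDyer.BirchSwinnertonDyer.Theorems.ManinLocalTwoThreeNeronSqueezeTwenty
import HarnessLib

/-!
# The `η`-identities of `X₀(20)` and `|c| = 1` on `X₀(20)` — unconditionally (first non-CM level)

Cell bsd-f2-manin, route `ManinLocalTwoThree` (crux C2 `ManinOddAtFour`: `4 ∣ 20`).  We discharge the three
`q`-asymptotics (T1)₂₀–(T3)₂₀ at `i∞` of `NeronSqueezeTwenty.abs_maninConstant_eq_one_twenty_of_tendsto`: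

  (T1)₂₀ `((2πi)⁻¹x′ + φ₂₀(2y − 2x − 4))/q → 0`,  (T2)₂₀ `((2πi)⁻¹y′ + φ₂₀(3x² + 2y))/q → 0`,
  (T3)₂₀ `y² − 2xy − 4y − x³ → 0`,

for `x = η(4τ)η(10τ)⁵/(η(2τ)η(20τ)⁵) = E₄E₁₀⁵/(q²E₂E₂₀⁵)`, `y = η(4τ)η(5τ)⁵/(η(τ)η(20τ)⁵) = E₄E₅⁵/(q³E₁E₂₀⁵)`,
`φ₂₀ = η(2τ)²η(10τ)² = qE₂²E₁₀²`.  METHOD (as at levels 27, 32, 36): by the logarithmic derivatives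
(`EulerRemaindersTwenty.deriv_x20`, `deriv_y20`) each target is `G/(q^k · unit)` with `G` polynomial in
`q, E₁, E₂, E₄, E₅, E₁₀, E₂₀` and their derivatives, `k = 3, 4, 6`; the remainder calculus
(`ManinLocalTwoThreeQRemainderCalculus`) computes `G` modulo `o(q^k)` from Euler's pentagonal truncations
`E₁ ≡ 1 − q − q² + q⁵`, `E₂ ≡ 1 − q² − q⁴`, `E₄ ≡ 1 − q⁴`, `E₅ ≡ 1 − q⁵`, `E₁₀ ≡ E₂₀ ≡ 1 (mod q⁷)` (powers
pre-reduced modulo `q^{k+1}`), and each truncation vanishes modulo `X^{k+1}` (`ring`), so `G = o(q^k)`.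
CONSEQUENCES: `x′ = −2πiφ₂₀(2y − 2x − 4)`, `y′ = −2πiφ₂₀(3x² + 2y)`, `y² − 2xy − 4y = x³` on `ℍ` (the
`η`-quotients parametrise the globally minimal model `[−2, 0, −4, 0, 0] ≅ 20a1`); (S2)₂₀; and, by the NÉRON
SQUEEZE (`NeronSqueeze`, no complex multiplication at this level), **`|D.maninConstant| = 1` for every
globally minimal `W/ℚ` and every `X₀(20)`-parametrisation datum `D` of `W` with the lattice clause** — no
modularity, CDT or printed Manin-constant hypothesis (`abs_maninConstant_eq_one_twenty`), hence `2 ∤ c`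
there (the crux C2 at `N = 20` without its fact hypotheses).  BSD is not proved by this; C2/C3 stay open.
-/

set_option autoImplicit false
set_option linter.dupNamespace false

noncomputable section

open Complex Filter Topology Set Asymptotics Polynomial
open UpperHalfPlane hiding I
open scoped Real Topology Manifold MatrixGroups
open Literature.NumberTheory.EllipticCurves Literature.NumberTheory.EllipticCurves.ModularForms

namespace Summit.BirchSwinnertonDyer.BirchSwinnertonDyer.Theorems.ManinLocalTwoThree.EtaIdentitiesTwenty

open QRemainder EulerRemainders EulerRemaindersTwenty

/-! ## 1. The `q`-asymptotics (T1)₂₀, (T2)₂₀, (T3)₂₀ at `i∞` -/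

/-- **(T1)₂₀**: `((2πi)⁻¹x′ + φ₂₀(2y − 2x − 4))/q → 0` at `i∞` (window `q⁻³ … q⁰`: remainders to order `3`).
[folklore] -/
theorem tendsto_T1 :
    Tendsto (fun τ : ℍ ↦ ((2 * π * I)⁻¹
      * deriv (etaQuotient 20 (expFn [(2, -1), (4, 1), (10, 5), (20, -5)]) ∘ ofComplex) τ
      + cuspFormEtaProductTwenty τ * (2 * etaQuotient 20 (expFn [(1, -1), (4, 1), (5, 5), (20, -5)]) τ
        - 2 * etaQuotient 20 (expFn [(2, -1), (4, 1), (10, 5), (20, -5)]) τ - 4))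
      / Function.Periodic.qParam 1 (τ : ℂ)) atImInfty (𝓝 0) := by
  have h2pi : (2 * π * I : ℂ) ≠ 0 := by simp [Real.pi_ne_zero, I_ne_zero]
  -- Euler remainders to order 3
  have hE1 := QRemainder.reduce (1 - X - X ^ 2) X (by ring)
    (tendsto_mono (show 3 ≤ 6 by norm_num) tendsto_eulerFn_one)
  have hE2 := QRemainder.reduce (1 - X ^ 2) (-1) (by ring)
    (tendsto_mono (show 3 ≤ 6 by norm_num) tendsto_eulerFn_two)
  have hE4 := QRemainder.reduce 1 (-1) (by ring)
    (tendsto_mono (show 3 ≤ 7 by norm_num) EulerRemaindersThirtyTwo.tendsto_eulerFn_four)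
  have hE5 := QRemainder.reduce 1 (-X) (by ring)
    (tendsto_mono (show 3 ≤ 6 by norm_num) tendsto_eulerFn_five)
  have hE10 := tendsto_eulerFn (δ := 10) (m := 3) (by norm_num)
  have hE20 := tendsto_eulerFn (δ := 20) (m := 3) (by norm_num)
  -- `T_δ = (2πi)⁻¹ E_δ′` to order 3: `T₂ ≡ −2q²`, `T₄ ≡ T₁₀ ≡ T₂₀ ≡ 0`
  have hT2 := QRemainder.reduce (-2 * X ^ 2) (-4) (by ring)
    (tendsto_mono (show 3 ≤ 6 by norm_num) (QRemainder.congr_poly (P' := -2 * X ^ 2 - 4 * X ^ 4)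
      (by rw [← mul_assoc, ← map_mul, inv_mul_cancel₀ h2pi, map_one, one_mul])
      (QRemainder.const_mul (2 * π * I)⁻¹ tendsto_deriv_eulerFn_two)))
  have hT4 := QRemainder.reduce 0 (-4) (by ring)
    (tendsto_mono (show 3 ≤ 7 by norm_num) (QRemainder.congr_poly (P' := -4 * X ^ 4)
      (by rw [← mul_assoc, ← map_mul, inv_mul_cancel₀ h2pi, map_one, one_mul])
      (QRemainder.const_mul (2 * π * I)⁻¹ EulerRemaindersThirtyTwo.tendsto_deriv_eulerFn_four)))
  have hT10 := QRemainder.congr_poly (P' := 0) (by rw [mul_zero])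
    (QRemainder.const_mul (2 * π * I)⁻¹ (tendsto_deriv_eulerFn (δ := 10) (m := 3) (by norm_num)))
  have hT20 := QRemainder.congr_poly (P' := 0) (by rw [mul_zero])
    (QRemainder.const_mul (2 * π * I)⁻¹ (tendsto_deriv_eulerFn (δ := 20) (m := 3) (by norm_num)))
  -- `G₁ = E₁E₁₀⁴·Bx + 2E₂⁴E₄E₅⁵E₁₀²E₂₀ − 2q(E₁E₂³E₄E₁₀⁷E₂₀) − 4q³(E₁E₂⁴E₁₀²E₂₀⁶)`,
  -- `Bx = T₄E₂E₁₀E₂₀ + 5T₁₀E₂E₄E₂₀ − 2E₂E₄E₁₀E₂₀ − T₂E₄E₁₀E₂₀ − 5T₂₀E₂E₄E₁₀`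
  have hA := QRemainder.mul (QRemainder.mul (QRemainder.mul hT4 hE2) hE10) hE20
  have hB := QRemainder.mul (QRemainder.mul (QRemainder.mul (QRemainder.const_mul 5 hT10) hE2) hE4) hE20
  have hC := QRemainder.mul (QRemainder.mul (QRemainder.mul (QRemainder.const_mul 2 hE2) hE4) hE10) hE20
  have hD := QRemainder.mul (QRemainder.mul (QRemainder.mul hT2 hE4) hE10) hE20
  have hE := QRemainder.mul (QRemainder.mul (QRemainder.mul (QRemainder.const_mul 5 hT20) hE2) hE4) hE10
  have hBx := QRemainder.sub (QRemainder.sub (QRemainder.sub (QRemainder.add hA hB) hC) hD) hE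
  have h1 := QRemainder.mul (QRemainder.mul hE1 (QRemainder.pow hE10 4)) hBx
  have h2 := QRemainder.mul (QRemainder.mul (QRemainder.mul (QRemainder.mul
    (QRemainder.const_mul 2 (QRemainder.pow hE2 4)) hE4) (QRemainder.pow hE5 5)) (QRemainder.pow hE10 2)) hE20
  have h3 := QRemainder.const_mul 2 (QRemainder.qParam_pow_mul 1 (QRemainder.mul (QRemainder.mul
    (QRemainder.mul (QRemainder.mul hE1 (QRemainder.pow hE2 3)) hE4) (QRemainder.pow hE10 7)) hE20))
  have h4 := QRemainder.const_mul 4 (QRemainder.qParam_pow_mul 3 (QRemainder.mul (QRemainder.mul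
    (QRemainder.mul hE1 (QRemainder.pow hE2 4)) (QRemainder.pow hE10 2)) (QRemainder.pow hE20 6)))
  have hG := QRemainder.reduce 0
    (6 + 8 * X - 18 * X ^ 2 - 32 * X ^ 3 + 24 * X ^ 4 + 38 * X ^ 5 - 16 * X ^ 6 - 20 * X ^ 7
      + 4 * X ^ 8 + 4 * X ^ 9) (by simp only [map_ofNat]; ring)
    (QRemainder.sub (QRemainder.sub (QRemainder.add h1 h2) h3) h4)
  have hlim := (QRemainder.tendsto_div_pow 3 le_rfl hG).mul
    ((((isIntUnitQExp_eulerFn (by norm_num : 0 < 1)).tendsto_one).mul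
      ((((isIntUnitQExp_eulerFn (by norm_num : 0 < 2)).tendsto_one.pow 2)).mul
      ((isIntUnitQExp_eulerFn (by norm_num : 0 < 20)).tendsto_one.pow 6))).inv₀ (by norm_num))
  rw [zero_mul] at hlim
  refine hlim.congr fun τ ↦ ?_
  have hE1' := eulerFn_ne_zero (by norm_num : 0 < 1) τ
  have hE2' := eulerFn_ne_zero (by norm_num : 0 < 2) τ
  have hE4' := eulerFn_ne_zero (by norm_num : 0 < 4) τ
  have hE10' := eulerFn_ne_zero (by norm_num : 0 < 10) τ
  have hE20' := eulerFn_ne_zero (by norm_num : 0 < 20) τ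
  have hq := qParam_ne_zero τ
  rw [deriv_x20, x20_eq, y20_eq, etaProductTwenty_eq]
  field_simp
  ring

/-- **(T2)₂₀**: `((2πi)⁻¹y′ + φ₂₀(3x² + 2y))/q → 0` at `i∞` (window `q⁻⁴ … q⁰`: remainders to order `4`).
[folklore] -/
theorem tendsto_T2 :
    Tendsto (fun τ : ℍ ↦ ((2 * π * I)⁻¹
      * deriv (etaQuotient 20 (expFn [(1, -1), (4, 1), (5, 5), (20, -5)]) ∘ ofComplex) τ
      + cuspFormEtaProductTwenty τ * (3 * etaQuotient 20 (expFn [(2, -1), (4, 1), (10, 5), (20, -5)]) τ ^ 2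
        + 2 * etaQuotient 20 (expFn [(1, -1), (4, 1), (5, 5), (20, -5)]) τ))
      / Function.Periodic.qParam 1 (τ : ℂ)) atImInfty (𝓝 0) := by
  have h2pi : (2 * π * I : ℂ) ≠ 0 := by simp [Real.pi_ne_zero, I_ne_zero]
  -- Euler remainders to order 4
  have hE1 := QRemainder.reduce (1 - X - X ^ 2) 1 (by ring)
    (tendsto_mono (show 4 ≤ 6 by norm_num) tendsto_eulerFn_one)
  have hE2 := tendsto_mono (show 4 ≤ 6 by norm_num) tendsto_eulerFn_two
  have hE4 := tendsto_mono (show 4 ≤ 7 by norm_num) EulerRemaindersThirtyTwo.tendsto_eulerFn_four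
  have hE5 := QRemainder.reduce 1 (-1) (by ring)
    (tendsto_mono (show 4 ≤ 6 by norm_num) tendsto_eulerFn_five)
  have hE10 := tendsto_eulerFn (δ := 10) (m := 4) (by norm_num)
  have hE20 := tendsto_eulerFn (δ := 20) (m := 4) (by norm_num)
  -- `T₁ ≡ −q − 2q²`, `T₄ ≡ −4q⁴`, `T₅ ≡ T₂₀ ≡ 0` to order 4
  have hT1 := QRemainder.reduce (-X - 2 * X ^ 2) 5 (by ring)
    (tendsto_mono (show 4 ≤ 6 by norm_num) (QRemainder.congr_poly (P' := -X - 2 * X ^ 2 + 5 * X ^ 5)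
      (by rw [← mul_assoc, ← map_mul, inv_mul_cancel₀ h2pi, map_one, one_mul])
      (QRemainder.const_mul (2 * π * I)⁻¹ tendsto_deriv_eulerFn_one)))
  have hT4 := tendsto_mono (show 4 ≤ 7 by norm_num) (QRemainder.congr_poly (P' := -4 * X ^ 4)
      (by rw [← mul_assoc, ← map_mul, inv_mul_cancel₀ h2pi, map_one, one_mul])
      (QRemainder.const_mul (2 * π * I)⁻¹ EulerRemaindersThirtyTwo.tendsto_deriv_eulerFn_four))
  have hT5 := QRemainder.reduce 0 (-5) (by ring)
    (tendsto_mono (show 4 ≤ 6 by norm_num) (QRemainder.congr_poly (P' := -5 * X ^ 5)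
      (by rw [← mul_assoc, ← map_mul, inv_mul_cancel₀ h2pi, map_one, one_mul])
      (QRemainder.const_mul (2 * π * I)⁻¹ tendsto_deriv_eulerFn_five)))
  have hT20 := QRemainder.congr_poly (P' := 0) (by rw [mul_zero])
    (QRemainder.const_mul (2 * π * I)⁻¹ (tendsto_deriv_eulerFn (δ := 20) (m := 4) (by norm_num)))
  -- `G₂ = E₅⁴E₂₀⁴·By + 3E₁²E₄²E₁₀¹² + 2q(E₁E₂²E₄E₅⁵E₁₀²E₂₀⁵)`,
  -- `By = T₄E₁E₅E₂₀ + 5T₅E₁E₄E₂₀ − 3E₁E₄E₅E₂₀ − T₁E₄E₅E₂₀ − 5T₂₀E₁E₄E₅`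
  have hA := QRemainder.mul (QRemainder.mul (QRemainder.mul hT4 hE1) hE5) hE20
  have hB := QRemainder.mul (QRemainder.mul (QRemainder.mul (QRemainder.const_mul 5 hT5) hE1) hE4) hE20
  have hC := QRemainder.mul (QRemainder.mul (QRemainder.mul (QRemainder.const_mul 3 hE1) hE4) hE5) hE20
  have hD := QRemainder.mul (QRemainder.mul (QRemainder.mul hT1 hE4) hE5) hE20
  have hE := QRemainder.mul (QRemainder.mul (QRemainder.mul (QRemainder.const_mul 5 hT20) hE1) hE4) hE5
  have hBy := QRemainder.sub (QRemainder.sub (QRemainder.sub (QRemainder.add hA hB) hC) hD) hE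
  have h1 := QRemainder.mul (QRemainder.mul (QRemainder.pow hE5 4) (QRemainder.pow hE20 4)) hBy
  have h2 := QRemainder.mul (QRemainder.mul (QRemainder.const_mul 3 (QRemainder.pow hE1 2))
    (QRemainder.pow hE4 2)) (QRemainder.pow hE10 12)
  have h3 := QRemainder.const_mul 2 (QRemainder.qParam_pow_mul 1 (QRemainder.mul (QRemainder.mul
    (QRemainder.mul (QRemainder.mul (QRemainder.mul hE1 (QRemainder.pow hE2 2)) hE4) (QRemainder.pow hE5 5))
    (QRemainder.pow hE10 2)) (QRemainder.pow hE20 5)))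
  have hG := QRemainder.reduce 0
    (12 + 9 * X - 11 * X ^ 3 - 10 * X ^ 4 - 7 * X ^ 5 - 2 * X ^ 6 + 7 * X ^ 7 + 2 * X ^ 8
      + 2 * X ^ 9 + 2 * X ^ 10) (by simp only [map_ofNat]; ring)
    (QRemainder.add (QRemainder.add h1 h2) h3)
  have hlim := (QRemainder.tendsto_div_pow 4 le_rfl hG).mul
    ((((isIntUnitQExp_eulerFn (by norm_num : 0 < 1)).tendsto_one.pow 2).mul
      ((isIntUnitQExp_eulerFn (by norm_num : 0 < 20)).tendsto_one.pow 10)).inv₀ (by norm_num))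
  rw [zero_mul] at hlim
  refine hlim.congr fun τ ↦ ?_
  have hE1' := eulerFn_ne_zero (by norm_num : 0 < 1) τ
  have hE2' := eulerFn_ne_zero (by norm_num : 0 < 2) τ
  have hE4' := eulerFn_ne_zero (by norm_num : 0 < 4) τ
  have hE5' := eulerFn_ne_zero (by norm_num : 0 < 5) τ
  have hE20' := eulerFn_ne_zero (by norm_num : 0 < 20) τ
  have hq := qParam_ne_zero τ
  rw [deriv_y20, x20_eq, y20_eq, etaProductTwenty_eq]
  field_simp
  ring

/-- **(T3)₂₀**: `y² − 2xy − 4y − x³ → 0` at `i∞` (window `q⁻⁶ … q⁰`: remainders to order `6`,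
`E₂³E₄²E₅¹⁰E₂₀⁵ − 2qE₁E₂²E₄²E₅⁵E₁₀⁵E₂₀⁵ − 4q³E₁E₂³E₄E₅⁵E₂₀¹⁰ − E₁²E₄³E₁₀¹⁵ ≡ 0 (mod q⁷)`). [folklore] -/
theorem tendsto_T3 :
    Tendsto (fun τ : ℍ ↦ etaQuotient 20 (expFn [(1, -1), (4, 1), (5, 5), (20, -5)]) τ ^ 2
      - 2 * etaQuotient 20 (expFn [(2, -1), (4, 1), (10, 5), (20, -5)]) τ
        * etaQuotient 20 (expFn [(1, -1), (4, 1), (5, 5), (20, -5)]) τ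
      - 4 * etaQuotient 20 (expFn [(1, -1), (4, 1), (5, 5), (20, -5)]) τ
      - etaQuotient 20 (expFn [(2, -1), (4, 1), (10, 5), (20, -5)]) τ ^ 3) atImInfty (𝓝 0) := by
  have hE1 := tendsto_eulerFn_one
  have hE2 := tendsto_eulerFn_two
  have hE4 := tendsto_mono (show 6 ≤ 7 by norm_num) EulerRemaindersThirtyTwo.tendsto_eulerFn_four
  have hE5 := tendsto_eulerFn_five
  have hE10 := tendsto_eulerFn (δ := 10) (m := 6) (by norm_num)
  have hE20 := tendsto_eulerFn (δ := 20) (m := 6) (by norm_num)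
  -- pre-reduced powers modulo `X⁷`
  have r23 := QRemainder.reduce (1 - 3 * X ^ 2 + 5 * X ^ 6) (-3 * X ^ 3 - X ^ 5) (by ring)
    (QRemainder.pow hE2 3)
  have r22 := QRemainder.reduce (1 - 2 * X ^ 2 - X ^ 4 + 2 * X ^ 6) X (by ring) (QRemainder.pow hE2 2)
  have r42 := QRemainder.reduce (1 - 2 * X ^ 4) X (by ring) (QRemainder.pow hE4 2)
  have r43 := QRemainder.reduce (1 - 3 * X ^ 4) (3 * X - X ^ 5) (by ring) (QRemainder.pow hE4 3)
  have r55 := QRemainder.reduce (1 - 5 * X ^ 5) (10 * X ^ 3 - 10 * X ^ 8 + 5 * X ^ 13 - X ^ 18) (by ring)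
    (QRemainder.pow hE5 5)
  have r510 := QRemainder.reduce (1 - 10 * X ^ 5) (25 * X ^ 3) (by ring) (QRemainder.pow r55 2)
  have r12 := QRemainder.reduce (1 - 2 * X - X ^ 2 + 2 * X ^ 3 + X ^ 4 + 2 * X ^ 5 - 2 * X ^ 6) (-2 + X ^ 3)
    (by ring) (QRemainder.pow hE1 2)
  -- `G₃ = E₂³E₄²E₅¹⁰E₂₀⁵ − 2q(E₁E₂²E₄²E₅⁵E₁₀⁵E₂₀⁵) − 4q³(E₁E₂³E₄E₅⁵E₂₀¹⁰) − E₁²E₄³E₁₀¹⁵`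
  have h1 := QRemainder.mul (QRemainder.mul (QRemainder.mul r23 r42) r510) (QRemainder.pow hE20 5)
  have h2 := QRemainder.const_mul 2 (QRemainder.qParam_pow_mul 1 (QRemainder.mul (QRemainder.mul
    (QRemainder.mul (QRemainder.mul (QRemainder.mul hE1 r22) r42) r55) (QRemainder.pow hE10 5))
    (QRemainder.pow hE20 5)))
  have h3 := QRemainder.const_mul 4 (QRemainder.qParam_pow_mul 3 (QRemainder.mul (QRemainder.mul
    (QRemainder.mul (QRemainder.mul hE1 r23) hE4) r55) (QRemainder.pow hE20 10)))
  have h4 := QRemainder.mul (QRemainder.mul r12 r43) (QRemainder.pow hE10 15)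
  have hG := QRemainder.reduce 0
    (X - 2 * X ^ 2 - 52 * X ^ 3 + 34 * X ^ 4 + 114 * X ^ 5 - 28 * X ^ 6 + 84 * X ^ 7 - 190 * X ^ 8
      - 212 * X ^ 9 + 80 * X ^ 10 - 40 * X ^ 11 + 280 * X ^ 12 + 100 * X ^ 13 - 40 * X ^ 14 - 100 * X ^ 16)
    (by simp only [map_ofNat]; ring)
    (QRemainder.sub (QRemainder.sub (QRemainder.sub h1 h2) h3) h4)
  have hlim := (QRemainder.tendsto_div_pow 6 le_rfl hG).mul
    (((((isIntUnitQExp_eulerFn (by norm_num : 0 < 1)).tendsto_one.pow 2).mul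
      ((isIntUnitQExp_eulerFn (by norm_num : 0 < 2)).tendsto_one.pow 3)).mul
      ((isIntUnitQExp_eulerFn (by norm_num : 0 < 20)).tendsto_one.pow 15)).inv₀ (by norm_num))
  rw [zero_mul] at hlim
  refine hlim.congr fun τ ↦ ?_
  have hE1' := eulerFn_ne_zero (by norm_num : 0 < 1) τ
  have hE2' := eulerFn_ne_zero (by norm_num : 0 < 2) τ
  have hE20' := eulerFn_ne_zero (by norm_num : 0 < 20) τ
  have hq := qParam_ne_zero τ
  rw [x20_eq, y20_eq]
  field_simp

/-! ## 2. The identities, (S2)₂₀, and `|c| = 1` on `X₀(20)` — unconditionally -/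

/-- **`x′ = −2πi φ₂₀ · (2y − 2x − 4)`** on `ℍ`. [folklore] -/
theorem deriv_x (τ : ℍ) :
    deriv (etaQuotient 20 (expFn [(2, -1), (4, 1), (10, 5), (20, -5)]) ∘ ofComplex) τ
      = -(2 * π * I * cuspFormEtaProductTwenty τ)
          * (2 * etaQuotient 20 (expFn [(1, -1), (4, 1), (5, 5), (20, -5)]) τ
            - 2 * etaQuotient 20 (expFn [(2, -1), (4, 1), (10, 5), (20, -5)]) τ - 4) :=
  LevelTwenty.deriv_x20_of_tendsto tendsto_T1 τ

/-- **`y′ = −2πi φ₂₀ · (3x² + 2y)`** on `ℍ`. [folklore] -/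
theorem deriv_y (τ : ℍ) :
    deriv (etaQuotient 20 (expFn [(1, -1), (4, 1), (5, 5), (20, -5)]) ∘ ofComplex) τ
      = -(2 * π * I * cuspFormEtaProductTwenty τ)
          * (3 * etaQuotient 20 (expFn [(2, -1), (4, 1), (10, 5), (20, -5)]) τ ^ 2
            + 2 * etaQuotient 20 (expFn [(1, -1), (4, 1), (5, 5), (20, -5)]) τ) :=
  LevelTwenty.deriv_y20_of_tendsto tendsto_T2 τ

/-- **The curve `y² − 2xy − 4y = x³`** on `ℍ`: the `η`-quotients `x = η₄η₁₀⁵/(η₂η₂₀⁵)`,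
`y = η₄η₅⁵/(η₁η₂₀⁵)` parametrise the globally minimal model `[−2, 0, −4, 0, 0]` of `X₀(20) = 20a1`.
[folklore] -/
theorem cubic (τ : ℍ) :
    etaQuotient 20 (expFn [(1, -1), (4, 1), (5, 5), (20, -5)]) τ ^ 2
      - 2 * etaQuotient 20 (expFn [(2, -1), (4, 1), (10, 5), (20, -5)]) τ
        * etaQuotient 20 (expFn [(1, -1), (4, 1), (5, 5), (20, -5)]) τ
      - 4 * etaQuotient 20 (expFn [(1, -1), (4, 1), (5, 5), (20, -5)]) τ
      = etaQuotient 20 (expFn [(2, -1), (4, 1), (10, 5), (20, -5)]) τ ^ 3 :=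
  LevelTwenty.cubic20_of_deriv deriv_x deriv_y tendsto_T3 τ

/-- **(S2)₂₀ unconditionally**: the period lattice of `φ₂₀ = η(2τ)²η(10τ)²` lies in the Néron lattice of
`20a1` (invariants `g₂ = −44/3`, `g₃ = −296/27`). [folklore] -/
theorem periodLatticeLe_twenty :
    ∃ L₁ : PeriodPair, L₁.g₂ = -44 / 3 ∧ L₁.g₃ = -296 / 27 ∧
      ∀ z ∈ periodLattice cuspFormEtaProductTwenty, z ∈ L₁.lattice :=
  NeronSqueezeTwenty.periodLatticeLe20_of_identities cubic deriv_x

/-- **`|c| = 1` on `X₀(20)`, unconditionally — the first non-CM level**: for every globally minimal `W/ℚ`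
and every `X₀(20)`-parametrisation datum `D` of `W` with the lattice clause `Λ_W = c·Λ_f`, `|c| = 1` — no
modularity, CDT or printed Manin-constant fact is assumed. [folklore] -/
theorem abs_maninConstant_eq_one_twenty (W : WeierstrassCurve ℚ) [W.IsElliptic] [W.IsGloballyMinimal]
    (D : ModularParametrizationData W 20)
    (hopt : ∀ z ∈ D.L.lattice, ∃ w ∈ periodLattice D.f, z = D.c * w) :
    |D.maninConstant| = 1 :=
  NeronSqueezeTwenty.abs_maninConstant_eq_one_twenty_of_tendsto tendsto_T1 tendsto_T2 tendsto_T3 W D hopt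

/-- **`2 ∤ c` on `X₀(20)`, unconditionally** (the crux `ManinOddAtFour` at the level `N = 20`, `4 ∣ 20`,
with none of its four fact hypotheses). [folklore] -/
theorem not_two_dvd_maninConstant_twenty (W : WeierstrassCurve ℚ) [W.IsElliptic] [W.IsGloballyMinimal]
    (D : ModularParametrizationData W 20)
    (hopt : ∀ z ∈ D.L.lattice, ∃ w ∈ periodLattice D.f, z = D.c * w) :
    ¬ (2 : ℤ) ∣ D.maninConstant := by
  have h := abs_maninConstant_eq_one_twenty W D hopt
  rintro ⟨t, ht⟩
  rw [ht, abs_mul] at h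
  have h2' : |(2 : ℤ)| = 2 := by norm_num
  rw [h2'] at h
  have := abs_nonneg t
  omega

end Summit.BirchSwinnertonDyer.BirchSwinnertonDyer.Theorems.ManinLocalTwoThree.EtaIdentitiesTwenty

end
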